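import Literature.NumberTheory.EllipticCurves.AnticyclotomicBigGaloisRep
import HarnessLib

/-!
# Route `ErratumRoadFive` (K2, `p ≥ 5`), crux (T) `Rest3TorsionBranchAtFive` (item
# stmt-BirchSwinnertonDyer-19702): SHAPIRO FOR `H⁰` IN THE CO-INDUCED MODEL — the LOCAL INVARIANTS of
# the big representation `M = T ⊗_𝒪 Λ_𝒪^*(Ψ⁻¹)` (`AnticyclotomicBigGaloisRep.bigRep`) at a place where
# `Ψ` has OPEN image are controlled by the `ker Ψ`-fixed part of `T`: they are killed by whatever kills
# it, and are FINITE of order `≤ (#A₀)^{p^s}` — the instantiation layer (β)(E) of THEOREM T♭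
# (memo PROOF-BDP §31.2 (E), §32.10, §33.8)

Cell `bsd-stepL` (run/shared/lean/pub/bsd-stepL/), seat `bsd-stepL-bdp` (prover g15, 2026-08-27), memo
`HOME/proof/PROOF-BDP.md` §31.2 / §33.9; `--supports stmt-BirchSwinnertonDyer-19702 --as helper`.

WHAT. For a group `H` (a decomposition group `G_{K_𝔭}`), `κ : H →ₜ* ℤ_p` (the anticyclotomic
character restricted to `G_{K_𝔭}`; image `p^s ℤ_p`, `p^s` = the number of primes of `K_∞` above `𝔭`)
and a discrete `𝒪`-linear representation `ρ` of `H` on `A` (`= E[p^∞] ⊗ 𝒪` restricted to `G_{K_𝔭}`),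
the invariants of `bigRep κ ρ` — smooth `p`-primary functions `Φ : ℤ_p → A` with
`ρ(h)(Φ(x − κ h)) = Φ(x)` — satisfy:
* `apply_mem_fixed_of_mem_invariants`: every value `Φ(x)` is fixed by `ker κ` (`= G_{K_{∞,w}}`);
* `smul_eq_zero_of_mem_invariants` (+ `pow` form): if `c ∈ 𝒪` kills the `ker κ`-fixed vectors of `A`
  then `C c` kills the invariants — with (L1) (`E(K_{∞,w})[p^∞] = E(ℚ_p)[p^∞] ≅ ℤ/p^k`, g14
  `TateTorsionRigidity*`) this is `hkillf` of `SelmerDefectAssemblySigma` with `c = ϖ^k`, i.e. `p^k`;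
* `eq_of_forall_apply_natCast_eq` / `finite_invariants` / `natCard_invariants_le`: if `κ(H) ⊇ p^s ℤ_p`
  then an invariant `Φ` is determined by its values at `0, 1, …, p^s − 1` (Shapiro: `M^H ↪ ⊕_{w∣𝔭} A^{ker}`),
  so the invariants are FINITE of order `≤ (#A₀)^{p^s}` for any finite submodule `A₀ ⊇` the `ker κ`-fixed
  vectors — `hB`/`[Finite …]` of `SelmerDefectAssemblySigma`.

HONEST FRAMING: theorems only (no definition, no named fact, no `sorry`); PURE ALGEBRA on the co-induced
model; that `(H, κ, ρ, A)` is `(G_{K_𝔭}, Ψ|, ρ_{E,p}|, E[p^∞] ⊗ 𝒪)` and that `A^{ker κ}` is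
`E(K_{∞,w})[p^∞] ⊗ 𝒪` is NOT asserted here (objects). Nothing is booked; no census word, tier or label
moves (T7).

References: [Castella2018] §2.1 (`𝒜 = T ⊗ Λ^*`, action `ρ ⊗ Ψ⁻¹`); [Castella2018Erratum] Lemma 2.1
(«the kernel of the second arrow is `H⁰(K_𝔭, M_g)/ϖ^m`»); [SkinnerUrban2014] Prop. 3.2.3 (Shapiro in
the co-induced model); memo PROOF-BDP §31.2 (E).
-/

set_option autoImplicit false
-- the Theorems namespace of this sub repeats the summit name by design (D-0017 nested layout)
set_option linter.dupNamespace false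

noncomputable section

open Literature.NumberTheory.GaloisRepresentations Literature.NumberTheory.EllipticCurves
  Literature.NumberTheory.EllipticCurves.BigRepModule

namespace Summit.BirchSwinnertonDyer.BirchSwinnertonDyer.Theorems.BigRepLocalInvariants

variable {𝒪 : Type*} [CommRing 𝒪] [TopologicalSpace 𝒪] {p : ℕ} [Fact p.Prime]
  {A : Type*} [AddCommGroup A] [Module 𝒪 A] [TopologicalSpace A] [DiscreteTopology A]
  {H : Type*} [Group H] [TopologicalSpace H] [ContinuousMul H]
  (κ : H →ₜ* Multiplicative ℤ_[p]) (ρ : ContinuousRep H 𝒪 A) [TopologicalSpace (PowerSeries 𝒪)]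

/-! ### §1 Values of an invariant function -/

/-- **An `H`-invariant `Φ ∈ T ⊗ Λ^*(Ψ⁻¹)` takes values fixed by `ker κ`** (`= G_{K_{∞,w}}`):
`(h·Φ)(x) = ρ(h)(Φ(x − κ h)) = ρ(h)(Φ(x))` for `κ h = 1`. [cite: Castella2018, §2.1 (action ρ ⊗ Ψ^{-1} on 𝒜 = T ⊗ Λ^*)] -/
theorem apply_eq_self_of_invariant {Φ : BigRepModule 𝒪 p A} (hΦ : ∀ h : H, bigRep κ ρ h Φ = Φ)
    {h : H} (hh : κ h = 1) (x : ℤ_[p]) : ρ h (Φ x) = Φ x := by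
  have := congrArg (fun Ψ : BigRepModule 𝒪 p A => Ψ x) (hΦ h)
  simpa [bigRep_apply_apply, hh] using this

/-- **The transport rule along `κ(H)`**: `Φ(x + κ h) = ρ(h)(Φ(x))` for an `H`-invariant `Φ` — an
invariant function is determined on each coset of `κ(H)` by one value. [cite: Castella2018, §2.1 (action ρ ⊗ Ψ^{-1} on 𝒜 = T ⊗ Λ^*)] -/
theorem apply_add_eq_of_invariant {Φ : BigRepModule 𝒪 p A} (hΦ : ∀ h : H, bigRep κ ρ h Φ = Φ)
    (h : H) (x : ℤ_[p]) : Φ (x + (κ h).toAdd) = ρ h (Φ x) := by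
  have := congrArg (fun Ψ : BigRepModule 𝒪 p A => Ψ (x + (κ h).toAdd)) (hΦ h)
  simp only [bigRep_apply_apply, add_sub_cancel_right] at this
  exact this.symm

/-! ### §2 What kills the `ker κ`-fixed vectors kills the invariants -/

/-- **`c • Φ = 0` for every `H`-invariant `Φ` if `c` kills the `ker κ`-fixed vectors of `A`.** With
(L1) — `A^{ker κ} = E(K_{∞,w})[p^∞] ⊗ 𝒪 = E(ℚ_p)[p^∞] ⊗ 𝒪 ≅ 𝒪/p^k` — this is the exponent bound
`p^k · H⁰(K_𝔭, M_E) = 0` of memo §31.2 (E). [cite: Castella2018Erratum, Lemma 2.1 (the defect H⁰(K_𝔭, M_g)/ϖ^m)] -/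
theorem smul_eq_zero_of_invariant {c : 𝒪}
    (hc : ∀ a : A, (∀ h : H, κ h = 1 → ρ h a = a) → c • a = 0)
    {Φ : BigRepModule 𝒪 p A} (hΦ : ∀ h : H, bigRep κ ρ h Φ = Φ) : c • Φ = 0 := by
  ext x
  rw [BigRepModule.smul_apply, BigRepModule.zero_apply]
  exact hc (Φ x) fun h hh => apply_eq_self_of_invariant κ ρ hΦ hh x

/-- The same for the constant power series `C c ∈ Λ_𝒪 = 𝒪⟦T⟧` and its powers: `(C c)^k • Φ = 0` if
`c^k` kills the `ker κ`-fixed vectors (the shape `π^k • w = 0`, `π = C ϖ`, of the Selmer-level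
assembly's `hkillf`). [cite: Castella2018Erratum, Lemma 2.1 (the defect H⁰(K_𝔭, M_g)/ϖ^m)] -/
theorem C_pow_smul_eq_zero_of_invariant {c : 𝒪} {k : ℕ}
    (hc : ∀ a : A, (∀ h : H, κ h = 1 → ρ h a = a) → c ^ k • a = 0)
    {Φ : BigRepModule 𝒪 p A} (hΦ : ∀ h : H, bigRep κ ρ h Φ = Φ) :
    (PowerSeries.C c : PowerSeries 𝒪) ^ k • Φ = 0 := by
  rw [← map_pow, C_smul]
  exact smul_eq_zero_of_invariant κ ρ hc hΦ

/-! ### §3 Shapiro: an invariant function is determined by `p^s` values (`κ(H) ⊇ p^s ℤ_p`) -/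

/-- **Two `H`-invariant functions agreeing at `0, 1, …, p^s − 1` are equal, when `κ(H) ⊇ p^s ℤ_p`**
(every `x ∈ ℤ_p` is `a + p^s y` with `a < p^s` — `PadicInt.appr` — and `p^s y = κ h`, so
`Φ(x) = ρ(h)(Φ(a))`). This is the injectivity half of Shapiro's `H⁰(K_𝔭, T ⊗ Λ^*) ≅ ⊕_{w ∣ 𝔭} H⁰(K_{∞,w}, T)`
in the co-induced model. [cite: SkinnerUrban2014, Prop. 3.2.3 (Shapiro, co-induced model)] -/
theorem eq_of_forall_apply_natCast_eq {s : ℕ}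
    (hsurj : ∀ y : ℤ_[p], ∃ h : H, (κ h).toAdd = (p : ℤ_[p]) ^ s * y)
    {Φ Ψ : BigRepModule 𝒪 p A} (hΦ : ∀ h : H, bigRep κ ρ h Φ = Φ) (hΨ : ∀ h : H, bigRep κ ρ h Ψ = Ψ)
    (heq : ∀ i : ℕ, i < p ^ s → Φ i = Ψ i) : Φ = Ψ := by
  ext x
  obtain ⟨y, hy⟩ := Ideal.mem_span_singleton'.mp (PadicInt.appr_spec s x)
  obtain ⟨h, hh⟩ := hsurj y
  have hx : x = (x.appr s : ℤ_[p]) + (κ h).toAdd := by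
    rw [hh, mul_comm, hy]; ring
  rw [hx, apply_add_eq_of_invariant κ ρ hΦ, apply_add_eq_of_invariant κ ρ hΨ,
    heq _ (PadicInt.appr_lt x s)]

/-- **The evaluation map `Φ ↦ (Φ(i))_{i < p^s}` on the invariants is INJECTIVE with values in any
submodule `A₀` containing the `ker κ`-fixed vectors.** [cite: SkinnerUrban2014, Prop. 3.2.3 (Shapiro, co-induced model)] -/
theorem eval_injective {s : ℕ} (hsurj : ∀ y : ℤ_[p], ∃ h : H, (κ h).toAdd = (p : ℤ_[p]) ^ s * y)
    (A₀ : Submodule 𝒪 A) (hA₀ : ∀ a : A, (∀ h : H, κ h = 1 → ρ h a = a) → a ∈ A₀) :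
    Function.Injective (fun Φ : {Φ : BigRepModule 𝒪 p A // ∀ h : H, bigRep κ ρ h Φ = Φ} =>
      fun i : Fin (p ^ s) => (⟨Φ.1 (i : ℕ), hA₀ _ fun _ hh =>
        apply_eq_self_of_invariant κ ρ Φ.2 hh _⟩ : A₀)) := by
  intro Φ Ψ hΦΨ
  apply Subtype.ext
  refine eq_of_forall_apply_natCast_eq κ ρ hsurj Φ.2 Ψ.2 fun i hi => ?_
  have := congrArg (fun F : Fin (p ^ s) → A₀ => ((F ⟨i, hi⟩ : A₀) : A)) hΦΨ
  exact this

/-- **The invariants are FINITE when the `ker κ`-fixed vectors lie in a finite submodule and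
`κ(H) ⊇ p^s ℤ_p`.** [cite: SkinnerUrban2014, Prop. 3.2.3 (Shapiro, co-induced model)] -/
theorem finite_invariantSubtype {s : ℕ}
    (hsurj : ∀ y : ℤ_[p], ∃ h : H, (κ h).toAdd = (p : ℤ_[p]) ^ s * y)
    (A₀ : Submodule 𝒪 A) (hA₀ : ∀ a : A, (∀ h : H, κ h = 1 → ρ h a = a) → a ∈ A₀) [Finite A₀] :
    Finite {Φ : BigRepModule 𝒪 p A // ∀ h : H, bigRep κ ρ h Φ = Φ} :=
  Finite.of_injective _ (eval_injective κ ρ hsurj A₀ hA₀)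

/-- **`#M^H ≤ (#A₀)^{p^s}`**: the ORDER BOUND of memo §31.2 (E) (`#H⁰(K_𝔭, M_E) ≤ p^{c₀}`,
`c₀ = k·d·s′` — here `(#A₀)^{p^s}` with `#A₀ = #(𝒪/p^k) = p^{kd}` and `p^s` the index of `κ(H)`).
[cite: SkinnerUrban2014, Prop. 3.2.3 (Shapiro, co-induced model)] -/
theorem natCard_invariantSubtype_le {s : ℕ}
    (hsurj : ∀ y : ℤ_[p], ∃ h : H, (κ h).toAdd = (p : ℤ_[p]) ^ s * y)
    (A₀ : Submodule 𝒪 A) (hA₀ : ∀ a : A, (∀ h : H, κ h = 1 → ρ h a = a) → a ∈ A₀) [Finite A₀] :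
    Nat.card {Φ : BigRepModule 𝒪 p A // ∀ h : H, bigRep κ ρ h Φ = Φ} ≤ Nat.card A₀ ^ (p ^ s) := by
  haveI : Finite (Fin (p ^ s) → A₀) := Pi.finite
  have h := Nat.card_le_card_of_injective _ (eval_injective κ ρ hsurj A₀ hA₀)
  rwa [Nat.card_pi, Finset.prod_const, Finset.card_univ, Fintype.card_fin] at h

/-! ### §4 The same for the submodule of invariants of the attached topological representation
(the currency of `SelmerDefectAssemblySigma`: `ρf.toTopRep.ρ.invariants`) -/

section TopRep

variable [ContinuousSMul (PowerSeries 𝒪) (BigRepModule 𝒪 p A)]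

/-- Membership in the invariants of the attached topological representation is invariance under every
`h`. [folklore] -/
theorem mem_invariants_iff (Φ : BigRepModule 𝒪 p A) :
    Φ ∈ (bigRep κ ρ).toTopRep.ρ.invariants ↔ ∀ h : H, bigRep κ ρ h Φ = Φ := Iff.rfl

/-- **`hkillf` of the Selmer-level assembly for `M_f = T ⊗ Λ^*`**: `(C c)^k` kills
`H⁰(H, bigRep κ ρ)` as soon as `c^k` kills the `ker κ`-fixed vectors of `A`. [cite: Castella2018Erratum, Lemma 2.1 (the defect H⁰(K_𝔭, M_g)/ϖ^m)] -/
theorem C_pow_smul_eq_zero_of_mem_invariants {c : 𝒪} {k : ℕ}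
    (hc : ∀ a : A, (∀ h : H, κ h = 1 → ρ h a = a) → c ^ k • a = 0)
    (Φ : BigRepModule 𝒪 p A) (hΦ : Φ ∈ (bigRep κ ρ).toTopRep.ρ.invariants) :
    (PowerSeries.C c : PowerSeries 𝒪) ^ k • Φ = 0 :=
  C_pow_smul_eq_zero_of_invariant κ ρ hc ((mem_invariants_iff κ ρ Φ).1 hΦ)

/-- **`[Finite …]` of the Selmer-level assembly for `M_f = T ⊗ Λ^*`**: the local invariants are finite
(`κ(H) ⊇ p^s ℤ_p`, `ker κ`-fixed vectors in a finite `A₀`). [cite: SkinnerUrban2014, Prop. 3.2.3 (Shapiro, co-induced model)] -/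
theorem finite_invariants {s : ℕ}
    (hsurj : ∀ y : ℤ_[p], ∃ h : H, (κ h).toAdd = (p : ℤ_[p]) ^ s * y)
    (A₀ : Submodule 𝒪 A) (hA₀ : ∀ a : A, (∀ h : H, κ h = 1 → ρ h a = a) → a ∈ A₀) [Finite A₀] :
    Finite (bigRep κ ρ).toTopRep.ρ.invariants := by
  haveI := finite_invariantSubtype κ ρ hsurj A₀ hA₀
  exact Finite.of_injective
    (fun Φ : (bigRep κ ρ).toTopRep.ρ.invariants =>
      (⟨Φ.1, (mem_invariants_iff κ ρ Φ.1).1 Φ.2⟩ :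
        {Φ : BigRepModule 𝒪 p A // ∀ h : H, bigRep κ ρ h Φ = Φ}))
    fun Φ Ψ h => Subtype.ext (congrArg Subtype.val h)

/-- **`hB` of the Selmer-level assembly for `M_f = T ⊗ Λ^*`**: `#H⁰(H, bigRep κ ρ) ≤ (#A₀)^{p^s}`.
[cite: SkinnerUrban2014, Prop. 3.2.3 (Shapiro, co-induced model)] -/
theorem natCard_invariants_le {s : ℕ}
    (hsurj : ∀ y : ℤ_[p], ∃ h : H, (κ h).toAdd = (p : ℤ_[p]) ^ s * y)
    (A₀ : Submodule 𝒪 A) (hA₀ : ∀ a : A, (∀ h : H, κ h = 1 → ρ h a = a) → a ∈ A₀) [Finite A₀] :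
    Nat.card (bigRep κ ρ).toTopRep.ρ.invariants ≤ Nat.card A₀ ^ (p ^ s) := by
  haveI := finite_invariantSubtype κ ρ hsurj A₀ hA₀
  refine le_trans (Nat.card_le_card_of_injective
    (fun Φ : (bigRep κ ρ).toTopRep.ρ.invariants =>
      (⟨Φ.1, (mem_invariants_iff κ ρ Φ.1).1 Φ.2⟩ :
        {Φ : BigRepModule 𝒪 p A // ∀ h : H, bigRep κ ρ h Φ = Φ}))
    fun Φ Ψ h => Subtype.ext (congrArg Subtype.val h)) ?_
  exact natCard_invariantSubtype_le κ ρ hsurj A₀ hA₀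

end TopRep

end Summit.BirchSwinnertonDyer.BirchSwinnertonDyer.Theorems.BigRepLocalInvariants

end
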